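import Literature.NumberTheory.NumberFields.CubicFieldExplicit
import Mathlib.RingTheory.DedekindDomain.AdicValuation
import Mathlib.Algebra.GroupWithZero.WithZero
import Mathlib.Tactic.Linarith
import Mathlib.Tactic.LinearCombination
import HarnessLib

/-!
# BirchSwinnertonDyer — rank ≥ 2 observatory: parity of `ord_𝔓(x − θ)` and the cubic-field glue

HONEST FRAMING: per-curve certified theorems and census instruments; no claim on BSD in rank ≥ 2.

Third generic file of the KERNEL-2DESC instrument (design `b2b-bsdr2-cert-3/KERNEL-2DESC.md`, (M4)
and the per-field glue of §4 A1/A3). For `E : y² = F(x) = x³ + Ax² + Bx + C` and a root `θ` of `F`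
in a field `L`, `F(x) = (x − θ)·q(x)` with `q(x) = x² + (θ + A)x + (θ² + Aθ + B)` and
`q(θ) = F′(θ) = 3θ² + 2Aθ + B`.

* `two_dvd_log_map_sub_of_sq_eq_mul_quad` — for ANY `ℤᵐ⁰`-valued valuation `v` on a field with
  `θ, c₁, c₀` `v`-integral and `v(θ² + c₁θ + c₀) = 1`: `y² = (x − θ)(x² + c₁x + c₀)`, `x ≠ θ`
  ⇒ `ord_v(x − θ)` is even (if `v x > 1` all of `x − θ`, `x² + c₁x + c₀` are dominated by `x`, so
  `2 ord y = 3 ord x = 3 ord(x − θ)`; if `v x ≤ 1` and `v(x − θ) < 1` then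
  `q(x) = q(θ) + (x − θ)(x + θ + c₁)` is a `v`-unit, so `2 ord y = ord(x − θ)`). This is the
  valuation content of Cassels' "the ideal `[x − θ]` is a square up to the finitely many prime
  factors of `F′(θ)`" (LEC §15, proof of the weak finite basis theorem) — the cubic-field
  analogue of the tree's split case `Literature…TwoDescentParity` (Silverman AEC X.1.1(c)).
* `two_dvd_log_valuation_sub_of_sq_eq`, `two_dvd_log_valuation_x_sub_theta` — the same for a
  height-one prime `v` of a Dedekind domain `R` (`θ, A, B, C ∈ R`, `F′(θ) ∉ v`), points over
  `Frac R`; used with `R = 𝓞 L`, `L = ℚ(θ)` the cubic field of the `2`-division polynomial.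
* glue to `Literature…MonicCubic` (the per-field power basis `1, θ, θ²` of `L = ℚ(θ)`,
  `[L:ℚ] = 3`, `F` irreducible): `powIndep_algebraMap` (independence of `1, θ, θ²`, the
  hypothesis `hlin` of the kernel lemma `Rank2Observatory2DescMuKernel`), `exists_coords`
  (its `hspan`), `norm_algebraMap_sub_theta : N_{L/ℚ}(x − θ) = F(x)` and hence
  `isSquare_norm_algebraMap_sub_theta : N(x − θ) = y²` for `(x, y) ∈ E(ℚ)` (the norm condition
  cutting `L(S,2)` down to `V₀`, design (M4)).

Sorry-free; axioms `propext`, `Classical.choice`, `Quot.sound`. References: J. W. S. Cassels,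
*Lectures on Elliptic Curves*, LMSST 24 (1991), §15; J. H. Silverman, *The Arithmetic of Elliptic
Curves*, 2nd ed. (2009), Thm. X.1.1(c).
-/

-- single-conjunct summit: `Summit.BirchSwinnertonDyer.BirchSwinnertonDyer.…` repeats the name by design
set_option linter.dupNamespace false

noncomputable section

open scoped WithZero
open Polynomial

namespace Summit.BirchSwinnertonDyer.BirchSwinnertonDyer.Rank2Observatory.TwoDescCubic

/-! ## The parity lemma for one valuation (irreducible cubic: one root `θ`, quadratic cofactor) -/

section Valuation

variable {L : Type*} [Field L] (v : Valuation L ℤᵐ⁰)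

/-- **Parity of `ord_v(x − θ)` on `y² = (x − θ)(x² + c₁x + c₀)`** when `θ, c₁, c₀` are
`v`-integral and the cofactor at `θ`, `θ² + c₁θ + c₀`, is a `v`-unit: `log v(x − θ)` is even
(`x ≠ θ`). Cubic-field version of the local computation behind "image of the `2`-descent lies in
`L(S,2)`". [cite: Cassels1991LecturesEllipticCurves, §15 proof of the weak finite basis theorem] -/
theorem two_dvd_log_map_sub_of_sq_eq_mul_quad {θ c₁ c₀ x y : L}
    (hθ : v θ ≤ 1) (hc₁ : v c₁ ≤ 1) (hc₀ : v c₀ ≤ 1) (hunit : v (θ ^ 2 + c₁ * θ + c₀) = 1)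
    (hx : x ≠ θ) (hy : y ^ 2 = (x - θ) * (x ^ 2 + c₁ * x + c₀)) :
    (2 : ℤ) ∣ WithZero.log (v (x - θ)) := by
  have hx₁ : x - θ ≠ 0 := sub_ne_zero.mpr hx
  have hv₁ : v (x - θ) ≠ 0 := (v.ne_zero_iff).mpr hx₁
  rcases lt_or_ge 1 (v x) with hxv | hxv
  · -- `v x > 1`: `x − θ` and the cofactor are dominated by `x`
    have hvx : v x ≠ 0 := ne_of_gt (lt_trans zero_lt_one hxv)
    have hsub : v (x - θ) = v x := v.map_sub_eq_of_lt_left (lt_of_le_of_lt hθ hxv)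
    have hx2 : v x < v (x ^ 2) := by
      rw [map_pow]
      calc v x = v x ^ 1 := (pow_one _).symm
        _ < v x ^ 2 := pow_lt_pow_right₀ hxv one_lt_two
    have hc₁x : v (c₁ * x) < v (x ^ 2) := by
      rw [map_mul]
      exact lt_of_le_of_lt (mul_le_of_le_one_left' hc₁) hx2
    have hc₀' : v c₀ < v (x ^ 2) := lt_of_le_of_lt hc₀ (lt_trans hxv hx2)
    have hq₁ : v (x ^ 2 + c₁ * x) = v (x ^ 2) := v.map_add_eq_of_lt_left hc₁x
    have hq : v (x ^ 2 + c₁ * x + c₀) = v x ^ 2 := by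
      rw [v.map_add_eq_of_lt_left (by rw [hq₁]; exact hc₀'), hq₁, map_pow]
    have key : v y ^ 2 = v x ^ 3 := by
      rw [← map_pow, hy, map_mul, hsub, hq]
      exact (pow_succ' (v x) 2).symm
    have hvy : v y ≠ 0 := by
      intro h
      rw [h, zero_pow two_ne_zero] at key
      exact pow_ne_zero 3 hvx key.symm
    have hlog := congrArg WithZero.log key
    rw [WithZero.log_pow, WithZero.log_pow, nsmul_eq_mul, nsmul_eq_mul] at hlog
    push_cast at hlog
    rw [hsub]
    exact ⟨WithZero.log (v y) - WithZero.log (v x), by linarith⟩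
  · -- `v x ≤ 1`: everything integral
    have hle : v (x - θ) ≤ 1 := v.map_sub_le hxv hθ
    rcases hle.lt_or_eq with hlt | heq
    · -- `v (x − θ) < 1`: the cofactor `q(x) = q(θ) + (x − θ)(x + θ + c₁)` is a unit
      have hlin : v (x + θ + c₁) ≤ 1 := v.map_add_le (v.map_add_le hxv hθ) hc₁
      have hprod : v ((x - θ) * (x + θ + c₁)) < 1 := by
        rw [map_mul]
        exact lt_of_le_of_lt (mul_le_of_le_one_right' hlin) hlt
      have hq : v (x ^ 2 + c₁ * x + c₀) = 1 := by
        have hqid : x ^ 2 + c₁ * x + c₀ = (θ ^ 2 + c₁ * θ + c₀) + (x - θ) * (x + θ + c₁) := by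
          ring
        rw [hqid, v.map_add_eq_of_lt_left (by rw [hunit]; exact hprod), hunit]
      have key : v y ^ 2 = v (x - θ) := by
        rw [← map_pow, hy, map_mul, hq, mul_one]
      have hlog := congrArg WithZero.log key
      rw [WithZero.log_pow, nsmul_eq_mul] at hlog
      push_cast at hlog
      exact ⟨WithZero.log (v y), by linarith⟩
    · rw [heq, WithZero.log_one]
      exact dvd_zero 2

end Valuation

/-! ## At a height-one prime of a Dedekind domain -/

section Dedekind

open IsDedekindDomain

variable {R : Type*} [CommRing R] [IsDedekindDomain R] {L : Type*} [Field L] [Algebra R L]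
  [IsFractionRing R L] (v : HeightOneSpectrum R)

/-- Parity at a prime `v ∤ q(θ) = θ² + c₁θ + c₀` (`θ, c₁, c₀ ∈ R`): for `x, y ∈ Frac R` with
`y² = (x − θ)(x² + c₁x + c₀)`, `x ≠ θ`, `ord_v(x − θ)` is even.
[cite: Cassels1991LecturesEllipticCurves, §15 proof of the weak finite basis theorem] -/
theorem two_dvd_log_valuation_sub_of_sq_eq {θ c₁ c₀ : R}
    (hunit : θ ^ 2 + c₁ * θ + c₀ ∉ v.asIdeal) {x y : L} (hx : x ≠ algebraMap R L θ)
    (hy : y ^ 2 = (x - algebraMap R L θ) *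
      (x ^ 2 + algebraMap R L c₁ * x + algebraMap R L c₀)) :
    (2 : ℤ) ∣ WithZero.log (v.valuation L (x - algebraMap R L θ)) := by
  refine two_dvd_log_map_sub_of_sq_eq_mul_quad (v.valuation L) (v.valuation_le_one θ)
    (v.valuation_le_one c₁) (v.valuation_le_one c₀) ?_ hx hy
  have hmap : algebraMap R L θ ^ 2 + algebraMap R L c₁ * algebraMap R L θ + algebraMap R L c₀ =
      algebraMap R L (θ ^ 2 + c₁ * θ + c₀) := by
    simp only [map_add, map_mul, map_pow]
  rw [hmap]
  exact v.valuation_eq_one_iff_notMem.mpr hunit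

/-- **Parity of `ord_𝔓(x − θ)` for `(x, y) ∈ E`, `E : y² = F(x) = x³ + Ax² + Bx + C`**,
`θ ∈ R` a root of `F`, at every prime `𝔓 ∤ F′(θ) = 3θ² + 2Aθ + B` (`x, y ∈ Frac R`, `x ≠ θ`):
the descent value `x − θ` has even valuation outside the prime divisors of `F′(θ)`.
[cite: Cassels1991LecturesEllipticCurves, §15 proof of the weak finite basis theorem] -/
theorem two_dvd_log_valuation_x_sub_theta {A B C θ : R}
    (hF : θ ^ 3 + A * θ ^ 2 + B * θ + C = 0) (hderiv : 3 * θ ^ 2 + 2 * A * θ + B ∉ v.asIdeal)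
    {x y : L} (hx : x ≠ algebraMap R L θ)
    (hE : y ^ 2 = x ^ 3 + algebraMap R L A * x ^ 2 + algebraMap R L B * x + algebraMap R L C) :
    (2 : ℤ) ∣ WithZero.log (v.valuation L (x - algebraMap R L θ)) := by
  have hunit : θ ^ 2 + (θ + A) * θ + (θ ^ 2 + A * θ + B) ∉ v.asIdeal := by
    have : θ ^ 2 + (θ + A) * θ + (θ ^ 2 + A * θ + B) = 3 * θ ^ 2 + 2 * A * θ + B := by ring
    rw [this]; exact hderiv
  refine two_dvd_log_valuation_sub_of_sq_eq v hunit hx (y := y) ?_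
  have hF' := congrArg (algebraMap R L) hF
  simp only [map_add, map_mul, map_pow, map_zero] at hF'
  simp only [map_add, map_mul, map_pow]
  linear_combination hE + hF'

end Dedekind

/-! ## Glue to the explicit cubic field `L = ℚ(θ)` of `Literature…MonicCubic` -/

section CubicField

open Literature.NumberTheory.NumberFields Module

variable {K : Type*} [Field K] [NumberField K] {a b c : ℤ} {θ : K}

/-- `1, θ, θ²` are `ℚ`-linearly independent in the cubic field (`F` irreducible, `[K:ℚ] = 3`) — the
hypothesis `hlin` of the kernel lemma, for `φ = algebraMap ℚ K`. [folklore] -/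
theorem powIndep_algebraMap (hirr : Irreducible (MonicCubic.polyQ a b c))
    (hθ : aeval θ (MonicCubic.poly a b c) = 0) (h3 : finrank ℚ K = 3) :
    ∀ c₀ c₁ c₂ : ℚ, algebraMap ℚ K c₂ * θ ^ 2 + algebraMap ℚ K c₁ * θ + algebraMap ℚ K c₀ = 0 →
      c₀ = 0 ∧ c₁ = 0 ∧ c₂ = 0 := by
  intro c₀ c₁ c₂ h
  have li := (MonicCubic.basis hirr hθ h3).linearIndependent
  rw [Fintype.linearIndependent_iff] at li
  have h0 := li ![c₀, c₁, c₂] (by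
    rw [Fin.sum_univ_three]
    simp only [MonicCubic.basis_apply, Matrix.cons_val_zero, Matrix.cons_val_one,
      Matrix.cons_val_two, Matrix.tail_cons, Matrix.head_cons, Fin.val_zero, Fin.val_one,
      Fin.val_two, pow_zero, pow_one, Algebra.smul_def]
    linear_combination h)
  have e0 := h0 0
  have e1 := h0 1
  have e2 := h0 2
  simp only [Matrix.cons_val_zero, Matrix.cons_val_one, Matrix.cons_val_two, Matrix.tail_cons,
    Matrix.head_cons] at e0 e1 e2
  exact ⟨e0, e1, e2⟩

/-- Every element of the cubic field is `c₂θ² + c₁θ + c₀` with `cᵢ ∈ ℚ` — the hypothesis `hspan`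
of the kernel lemma. [folklore] -/
theorem exists_coords (hirr : Irreducible (MonicCubic.polyQ a b c))
    (hθ : aeval θ (MonicCubic.poly a b c) = 0) (h3 : finrank ℚ K = 3) (z : K) :
    ∃ c₀ c₁ c₂ : ℚ, z = algebraMap ℚ K c₂ * θ ^ 2 + algebraMap ℚ K c₁ * θ + algebraMap ℚ K c₀ := by
  set B := MonicCubic.basis hirr hθ h3 with hB
  refine ⟨B.repr z 0, B.repr z 1, B.repr z 2, ?_⟩
  have hz := B.sum_repr z
  rw [Fin.sum_univ_three] at hz
  simp only [hB, MonicCubic.basis_apply, Fin.val_zero, Fin.val_one, Fin.val_two, pow_zero,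
    pow_one, Algebra.smul_def, mul_one] at hz
  simp only [hB]
  linear_combination -hz

/-- **`N_{L/ℚ}(x − θ) = F(x)`** for `x ∈ ℚ` (`F = X³ + aX² + bX + c` the minimal polynomial of
`θ`): the explicit norm form of `MonicCubic.norm_lin` at `(x, −1, 0)`. [folklore] -/
theorem norm_algebraMap_sub_theta (hirr : Irreducible (MonicCubic.polyQ a b c))
    (hθ : aeval θ (MonicCubic.poly a b c) = 0) (h3 : finrank ℚ K = 3) (x : ℚ) :
    Algebra.norm ℚ (algebraMap ℚ K x - θ) = x ^ 3 + a * x ^ 2 + b * x + c := by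
  have h := MonicCubic.norm_lin hirr hθ h3 x (-1) 0
  have hx : ((x : ℚ) : K) + ((-1 : ℚ) : K) * θ + ((0 : ℚ) : K) * θ ^ 2 = algebraMap ℚ K x - θ := by
    rw [eq_ratCast]; push_cast; ring
  rw [hx] at h
  rw [h, MonicCubic.normForm]
  ring

/-- For a rational point `(x, y)` on `y² = F(x)` the descent value `x − θ ∈ L` has square norm
`N(x − θ) = y²` (the norm condition of design (M4): `image μ ⊆ {ξ : N ξ ∈ ℚ*²}`). [folklore] -/
theorem norm_algebraMap_sub_theta_eq_sq (hirr : Irreducible (MonicCubic.polyQ a b c))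
    (hθ : aeval θ (MonicCubic.poly a b c) = 0) (h3 : finrank ℚ K = 3) {x y : ℚ}
    (hE : y ^ 2 = x ^ 3 + a * x ^ 2 + b * x + c) :
    Algebra.norm ℚ (algebraMap ℚ K x - θ) = y ^ 2 := by
  rw [norm_algebraMap_sub_theta hirr hθ h3, hE]

/-- … in particular `N(x − θ)` is a square in `ℚ`. [folklore] -/
theorem isSquare_norm_algebraMap_sub_theta (hirr : Irreducible (MonicCubic.polyQ a b c))
    (hθ : aeval θ (MonicCubic.poly a b c) = 0) (h3 : finrank ℚ K = 3) {x y : ℚ}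
    (hE : y ^ 2 = x ^ 3 + a * x ^ 2 + b * x + c) :
    IsSquare (Algebra.norm ℚ (algebraMap ℚ K x - θ)) :=
  ⟨y, by rw [norm_algebraMap_sub_theta_eq_sq hirr hθ h3 hE, sq]⟩

end CubicField

end Summit.BirchSwinnertonDyer.BirchSwinnertonDyer.Rank2Observatory.TwoDescCubic

end
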